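import Literature.AlgebraicGeometry.AbelianSchemes.AbelianSchemeUnitSectionChart
import Literature.AlgebraicGeometry.Morphisms.FibreChartRing
import Literature.AlgebraicGeometry.Morphisms.SectionConormalChart
import Literature.RingTheory.Smooth.AugmentationIdealCotangentLocalizedBase
import Mathlib.AlgebraicGeometry.Noetherian
import HarnessLib

/-!
# The unit-section chart of an abelian scheme under base change: the conormal module of the base-changed chart is the
# base change of the conormal module (Görtz–Wedhorn II, Remark 17.14/17.15; EGA IV₄ (16.2.3), (16.4.9))

Topic `Literature/AlgebraicGeometry/AbelianSchemes`; namespace `Literature.AlgebraicGeometry.AbelianSchemes.AbelianScheme`.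
Cell `hodgecm-mathlib` (D-0151), row II-2β (`shimura1998_prop26_definedOverQbar` `_holds` programme), junction J1 (A-p14):
the SCHEME-side identification asked for by A-p03 (04:08:14Z) / A-p11 (F2c, 04:27:42Z) «with the field `κ` replaced by an
arbitrary `R`-algebra `T`».  Theorems, two abbreviations and one `LinearEquiv` with body; no named fact, no instance (debt 0).

SETTING.  `𝒜 : AbelianScheme R`, an AFFINE open `W ⊆ 𝒜` containing the unit section (`η⁻¹ W = ⊤`), so that `S := Γ(𝒜, W)` is an
augmented `R`-algebra (`sectionAug`, A-p03 `Morphisms/SectionConormalChart`) with conormal module `I/I²`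
(`(augIdeal ε).Cotangent`); an `R`-algebra `T`, `𝒜_T := 𝒜.baseChange (algebraMap R T)` with projection
`p = bcFst : 𝒜_T → 𝒜` (`pullback.fst`) and the chart `W_T := p⁻¹ W` (`bcChart`; affine, containing the unit section of `𝒜_T`:
A-p11 `AbelianSchemeUnitSectionChart`).

WHAT IS PROVED.
* §1 `unit_preimage_bcChart_eq_top` — `η_T⁻¹ W_T = ⊤`; `isPullback_bcFst` — the defining square; `isAffineOpen_bcChart`.
* §2 `sectionAug_baseChange_fibreChartIso` — under A-p03's chart isomorphism `Θ : T ⊗_R Γ(𝒜, W) ≅ Γ(𝒜_T, W_T)`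
  (`Morphisms/FibreChartRing.fibreChartIso`) the augmentation of the base-changed chart IS the base-changed augmentation:
  `ε_{W_T} ∘ Θ = ε_T` (`RingTheory/Smooth/….baseChangeAugmentation`); hence `Θ(ker ε_T) = ker ε_{W_T}`
  (`map_fibreChartIso_augIdeal_baseChangeAugmentation`).
* §3 `cotangentChartBaseChangeEquiv` — **`(ker ε_T)/(ker ε_T)² ≃ₗ[T] (ker ε_{W_T})/(ker ε_{W_T})²**`, whence with A-p11's
  p605920 (`tensorCotangentEquivAugIdealBaseChangeAugmentation`) `T ⊗_R I/I² ≃ₗ[T] (ker ε_{W_T})/(ker ε_{W_T})²`;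
  `finite_cotangent_sectionAug` — `I/I²` is a finite `S`-module when `R` is noetherian.
* §4 `exists_ne_zero_free_cotangent_bcChart` — **generic freeness at the unit section**: over a noetherian domain `R` there is
  `r ≠ 0` with the conormal module of the chart `W_{R[1/r]}` of `𝒜_{R[1/r]}` FREE of finite rank over `R[1/r]`.

## References
* [GortzWedhorn2023] U. Görtz, T. Wedhorn, *Algebraic Geometry II* (2023), Remark 17.14, Remark 17.15 (1).
* [GortzWedhorn2020] U. Görtz, T. Wedhorn, *Algebraic Geometry I*, 2nd ed. (2020), Prop. 4.20, Remark 6.12 (2)–(3).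
* [EGAIV4] A. Grothendieck, EGA IV₄ (Publ. Math. IHÉS 32, 1967), (16.2.3), (16.4.9).
* [EGAIV3] A. Grothendieck, EGA IV₃ (1966), (8.9.4) (generic freeness passes to localisations).
-/

set_option autoImplicit false
set_option backward.isDefEq.respectTransparency false

noncomputable section

universe u

open CategoryTheory CategoryTheory.Limits AlgebraicGeometry TopologicalSpace Opposite TensorProduct
open Literature.RingTheory.Smooth
open scoped MonObj

namespace Literature.AlgebraicGeometry.AbelianSchemes.AbelianScheme

open Literature.AlgebraicGeometry.Morphisms Literature.AlgebraicGeometry.Morphisms.ChartRing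

variable {R : Type u} [CommRing R] (𝒜 : AbelianScheme R) (T : Type u) [CommRing T] [Algebra R T]

/-! ## §1 The base-changed chart `W_T = p⁻¹ W` -/

/-- The projection `p : 𝒜_T = 𝒜 ×_{Spec R} Spec T → 𝒜` (Mathlib `pullback.fst`, typed on `(𝒜.baseChange _).X.left`).
[cite: GortzWedhorn2020, Prop. 4.20] -/
abbrev bcFst : (𝒜.baseChange (algebraMap R T)).X.left ⟶ 𝒜.X.left := pullback.fst 𝒜.X.hom (specMap (algebraMap R T))

/-- The base-changed chart `W_T := p⁻¹ W ⊆ 𝒜_T`. [cite: GortzWedhorn2020, Prop. 4.20] -/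
abbrev bcChart (W : 𝒜.X.left.Opens) : (𝒜.baseChange (algebraMap R T)).X.left.Opens := 𝒜.bcFst T ⁻¹ᵁ W

/-- The defining cartesian square of `𝒜_T` in the shape consumed by `Morphisms/FibreChartRing` (`p = pullback.fst`,
`t = 𝒜_T → Spec T`). [cite: GortzWedhorn2020, Prop. 4.20] -/
theorem isPullback_bcFst :
    IsPullback (𝒜.bcFst T) (𝒜.baseChange (algebraMap R T)).X.hom 𝒜.X.hom
      (Spec.map (CommRingCat.ofHom (algebraMap R T))) :=
  IsPullback.of_hasPullback 𝒜.X.hom (specMap (algebraMap R T))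

/-- **The unit section of `𝒜_T` lies in `W_T`** when the unit section of `𝒜` lies in `W` (`η_T ≫ p = Spec(R → T) ≫ η`, A-p11
`unit_baseChange_left_comp_fst`). [cite: GortzWedhorn2023, Remark 17.14] -/
theorem unit_preimage_bcChart_eq_top {W : 𝒜.X.left.Opens} (heW : η[𝒜.X].left ⁻¹ᵁ W = ⊤) :
    η[(𝒜.baseChange (algebraMap R T)).X].left ⁻¹ᵁ 𝒜.bcChart T W = ⊤ := by
  change (η[(𝒜.baseChange (algebraMap R T)).X].left ≫ 𝒜.bcFst T) ⁻¹ᵁ W = ⊤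
  rw [show η[(𝒜.baseChange (algebraMap R T)).X].left ≫ 𝒜.bcFst T = specMap (algebraMap R T) ≫ η[𝒜.X].left from
    𝒜.unit_baseChange_left_comp_fst (algebraMap R T), Scheme.Hom.comp_preimage, heW]
  rfl

/-- `W_T` is affine for `W` affine (`p` is an affine morphism). [cite: GortzWedhorn2020, Prop. 12.3] -/
theorem isAffineOpen_bcChart {W : 𝒜.X.left.Opens} (hW : IsAffineOpen W) : IsAffineOpen (𝒜.bcChart T W) :=
  𝒜.isAffineOpen_fst_preimage (algebraMap R T) hW

/-! ## §2 The augmentation of the base-changed chart is the base-changed augmentation -/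

/-- **`ε_{W_T}(p^♯ s) = ε(s)` in `T`**: the augmentation of the base-changed chart on a pulled-back function is the image of
the augmentation (`η_T ≫ p = Spec(R → T) ≫ η` and `(Spec φ)^♯ = φ`). [cite: GortzWedhorn2023, Remark 17.14] -/
theorem sectionAug_baseChange_app {W : 𝒜.X.left.Opens} (heW : η[𝒜.X].left ⁻¹ᵁ W = ⊤) (s : ChartRing 𝒜.X.hom W) :
    sectionAug (𝒜.baseChange (algebraMap R T)).X.hom η[(𝒜.baseChange (algebraMap R T)).X].left
        ((𝒜.baseChange (algebraMap R T)).unit_left_comp_hom) (𝒜.unit_preimage_bcChart_eq_top T heW)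
        (ChartRing.mk _ _ ((𝒜.bcFst T).app W (val s))) =
      algebraMap R T (sectionAug 𝒜.X.hom η[𝒜.X].left 𝒜.unit_left_comp_hom heW s) := by
  have hcomp : η[(𝒜.baseChange (algebraMap R T)).X].left ≫ 𝒜.bcFst T = specMap (algebraMap R T) ≫ η[𝒜.X].left :=
    𝒜.unit_baseChange_left_comp_fst (algebraMap R T)
  have hle : (⊤ : (Spec (.of T)).Opens) ≤ (η[(𝒜.baseChange (algebraMap R T)).X].left ≫ 𝒜.bcFst T) ⁻¹ᵁ W := by
    rw [Scheme.Hom.comp_preimage]; exact (𝒜.unit_preimage_bcChart_eq_top T heW).ge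
  -- the identity at the level of ring maps `Γ(𝒜, W) → T`
  have e1 : (𝒜.bcFst T).app W ≫ η[(𝒜.baseChange (algebraMap R T)).X].left.appLE (𝒜.bcChart T W) ⊤
      (𝒜.unit_preimage_bcChart_eq_top T heW).ge =
      (η[(𝒜.baseChange (algebraMap R T)).X].left ≫ 𝒜.bcFst T).appLE W ⊤ hle := by
    rw [Scheme.Hom.app_eq_appLE, Scheme.Hom.appLE_comp_appLE]
  have e2 : ∀ {g : Spec (.of T) ⟶ 𝒜.X.left} (hg : η[(𝒜.baseChange (algebraMap R T)).X].left ≫ 𝒜.bcFst T = g)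
      (e : (⊤ : (Spec (.of T)).Opens) ≤ (η[(𝒜.baseChange (algebraMap R T)).X].left ≫ 𝒜.bcFst T) ⁻¹ᵁ W),
      (η[(𝒜.baseChange (algebraMap R T)).X].left ≫ 𝒜.bcFst T).appLE W ⊤ e = g.appLE W ⊤ (hg ▸ e) := by
    rintro _ rfl e; rfl
  have e3 : ∀ e : (⊤ : (Spec (.of T)).Opens) ≤ (specMap (algebraMap R T) ≫ η[𝒜.X].left) ⁻¹ᵁ W,
      (specMap (algebraMap R T) ≫ η[𝒜.X].left).appLE W ⊤ e =
        η[𝒜.X].left.appLE W ⊤ heW.ge ≫ (specMap (algebraMap R T)).appLE ⊤ ⊤ le_top :=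
    fun e => (Scheme.Hom.appLE_comp_appLE _ _ _ _ _ _ _).symm
  have e4 : (specMap (algebraMap R T)).appLE ⊤ ⊤ le_top ≫ (Scheme.ΓSpecIso (.of T)).hom =
      (Scheme.ΓSpecIso (.of R)).hom ≫ CommRingCat.ofHom (algebraMap R T) := by
    change (Spec.map (CommRingCat.ofHom (algebraMap R T))).appLE ⊤
      ((Spec.map (CommRingCat.ofHom (algebraMap R T))) ⁻¹ᵁ ⊤) le_rfl ≫ _ = _
    rw [Scheme.Hom.appLE_eq_app]
    exact Scheme.ΓSpecIso_naturality (CommRingCat.ofHom (algebraMap R T))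
  have key : (𝒜.bcFst T).app W ≫ η[(𝒜.baseChange (algebraMap R T)).X].left.appLE (𝒜.bcChart T W) ⊤
      (𝒜.unit_preimage_bcChart_eq_top T heW).ge ≫ (Scheme.ΓSpecIso (.of T)).hom =
      η[𝒜.X].left.appLE W ⊤ heW.ge ≫ (Scheme.ΓSpecIso (.of R)).hom ≫ CommRingCat.ofHom (algebraMap R T) := by
    rw [← Category.assoc, e1, e2 hcomp, e3, Category.assoc, e4]
  have hkey := congrArg (fun φ => φ.hom (val s)) key
  simp only [CommRingCat.hom_comp, RingHom.comp_apply, CommRingCat.hom_ofHom] at hkey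
  rw [sectionAug_apply, sectionAug_apply, val_mk]
  exact hkey

/-- **`ε_{W_T} ∘ Θ = ε_T`**: under the chart isomorphism `Θ : T ⊗_R Γ(𝒜, W) ≅ Γ(𝒜_T, W_T)` of `Morphisms/FibreChartRing`, the
augmentation of the unit section of `𝒜_T` is the base-changed augmentation `t ⊗ s ↦ t · ε(s)`
(`RingTheory/Smooth/….baseChangeAugmentation`). [cite: GortzWedhorn2023, Remark 17.14 and Remark 17.15 (1)]
[cite: EGAIV4, (16.2.3)] -/
theorem sectionAug_baseChange_fibreChartIso {W : 𝒜.X.left.Opens} (hW : IsAffineOpen W) (heW : η[𝒜.X].left ⁻¹ᵁ W = ⊤)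
    (x : T ⊗[R] ChartRing 𝒜.X.hom W) :
    sectionAug (𝒜.baseChange (algebraMap R T)).X.hom η[(𝒜.baseChange (algebraMap R T)).X].left
        ((𝒜.baseChange (algebraMap R T)).unit_left_comp_hom) (𝒜.unit_preimage_bcChart_eq_top T heW)
        (ChartRing.mk _ _ (fibreChartIso 𝒜.X.hom (𝒜.bcFst T) (𝒜.baseChange (algebraMap R T)).X.hom
          (𝒜.isPullback_bcFst T) hW x)) =
      baseChangeAugmentation (sectionAug 𝒜.X.hom η[𝒜.X].left 𝒜.unit_left_comp_hom heW) T x := by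
  induction x using TensorProduct.induction_on with
  | zero => simp only [map_zero]
  | tmul a s =>
    rw [baseChangeAugmentation_tmul, fibreChartIso_tmul, map_mul, map_mul, 𝒜.sectionAug_baseChange_app T heW s]
    -- `ε_{W_T}(t^♯ a) = a`: `t^♯ a` is the structure map of the chart ring of `𝒜_T`
    have ha : sectionAug (𝒜.baseChange (algebraMap R T)).X.hom η[(𝒜.baseChange (algebraMap R T)).X].left
        ((𝒜.baseChange (algebraMap R T)).unit_left_comp_hom) (𝒜.unit_preimage_bcChart_eq_top T heW)
        (ChartRing.mk _ _ (fibreConst (𝒜.bcFst T) (𝒜.baseChange (algebraMap R T)).X.hom W a)) = a :=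
      (sectionAug (𝒜.baseChange (algebraMap R T)).X.hom η[(𝒜.baseChange (algebraMap R T)).X].left
        ((𝒜.baseChange (algebraMap R T)).unit_left_comp_hom) (𝒜.unit_preimage_bcChart_eq_top T heW)).commutes a
    rw [ha]
  | add x y hx hy => simp only [map_add, hx, hy]

/-- **`Θ(ker ε_T) = ker ε_{W_T}`.** [cite: GortzWedhorn2023, Remark 17.15 (1)] [cite: EGAIV4, (16.2.3)] -/
theorem map_fibreChartIso_augIdeal_baseChangeAugmentation {W : 𝒜.X.left.Opens} (hW : IsAffineOpen W)
    (heW : η[𝒜.X].left ⁻¹ᵁ W = ⊤) :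
    (augIdeal (baseChangeAugmentation (sectionAug 𝒜.X.hom η[𝒜.X].left 𝒜.unit_left_comp_hom heW) T)).map
        ((ChartRing.mk (𝒜.baseChange (algebraMap R T)).X.hom (𝒜.bcChart T W)).comp
          (fibreChartIso 𝒜.X.hom (𝒜.bcFst T) (𝒜.baseChange (algebraMap R T)).X.hom
            (𝒜.isPullback_bcFst T) hW).toRingHom) =
      augIdeal (sectionAug (𝒜.baseChange (algebraMap R T)).X.hom η[(𝒜.baseChange (algebraMap R T)).X].left
        ((𝒜.baseChange (algebraMap R T)).unit_left_comp_hom) (𝒜.unit_preimage_bcChart_eq_top T heW)) := by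
  set Θ := (ChartRing.mk (𝒜.baseChange (algebraMap R T)).X.hom (𝒜.bcChart T W)).comp
    (fibreChartIso 𝒜.X.hom (𝒜.bcFst T) (𝒜.baseChange (algebraMap R T)).X.hom (𝒜.isPullback_bcFst T) hW).toRingHom
    with hΘ
  have hΘsurj : Function.Surjective Θ := by
    intro y
    refine ⟨(fibreChartIso 𝒜.X.hom (𝒜.bcFst T) (𝒜.baseChange (algebraMap R T)).X.hom (𝒜.isPullback_bcFst T)
      hW).symm (val y), ?_⟩
    rw [hΘ, RingHom.comp_apply, RingEquiv.toRingHom_eq_coe, RingHom.coe_coe, RingEquiv.apply_symm_apply]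
    rfl
  have hker : ∀ x, Θ x ∈ augIdeal (sectionAug (𝒜.baseChange (algebraMap R T)).X.hom
      η[(𝒜.baseChange (algebraMap R T)).X].left ((𝒜.baseChange (algebraMap R T)).unit_left_comp_hom)
      (𝒜.unit_preimage_bcChart_eq_top T heW)) ↔
      x ∈ augIdeal (baseChangeAugmentation (sectionAug 𝒜.X.hom η[𝒜.X].left 𝒜.unit_left_comp_hom heW) T) := by
    intro x
    rw [mem_augIdeal_iff, mem_augIdeal_iff, ← 𝒜.sectionAug_baseChange_fibreChartIso T hW heW x]
    rfl
  apply le_antisymm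
  · rw [Ideal.map_le_iff_le_comap]
    intro x hx
    exact (Ideal.mem_comap).2 ((hker x).2 hx)
  · intro y hy
    obtain ⟨x, rfl⟩ := hΘsurj y
    exact Ideal.mem_map_of_mem _ ((hker x).1 hy)

/-! ## §3 The conormal module of the base-changed chart -/

/-- A bijective `T`-algebra map `Θ` with `Θ(I) = J` induces a `T`-linear bijection `I/I² → J/J²`. [folklore] -/
private theorem mapCotangent_bijective_of_map_eq {A' B : Type u} [CommRing A'] [CommRing B] [Algebra T A'] [Algebra T B]
    (Θ : A' →ₐ[T] B) (hΘ : Function.Bijective Θ) (I : Ideal A') (J : Ideal B) (hJ : I.map (Θ : A' →+* B) = J)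
    (h : I ≤ J.comap Θ) : Function.Bijective (I.mapCotangent J Θ h) := by
  let Θe : A' ≃+* B := RingEquiv.ofBijective (Θ : A' →+* B) hΘ
  have hJe : I.map (Θe : A' →+* B) = J := hJ
  have hJ' : J = I.comap Θe.symm := by rw [← hJe, Ideal.map_comap_of_equiv]
  constructor
  · rw [injective_iff_map_eq_zero]
    intro y hy
    obtain ⟨x, rfl⟩ := Ideal.toCotangent_surjective _ y
    rw [Ideal.mapCotangent_toCotangent, Ideal.toCotangent_eq_zero] at hy
    rw [Ideal.toCotangent_eq_zero]
    have hsq : J ^ 2 = (I ^ 2).comap Θe.symm := by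
      rw [← hJe, ← Ideal.map_pow, Ideal.map_comap_of_equiv]
    rw [hsq, Ideal.mem_comap] at hy
    change Θe.symm (Θe (x : A')) ∈ I ^ 2 at hy
    rwa [RingEquiv.symm_apply_apply] at hy
  · intro y
    obtain ⟨⟨b, hb⟩, rfl⟩ := Ideal.toCotangent_surjective _ y
    have hb' : Θe.symm b ∈ I := by rw [hJ', Ideal.mem_comap] at hb; exact hb
    refine ⟨I.toCotangent ⟨Θe.symm b, hb'⟩, ?_⟩
    rw [Ideal.mapCotangent_toCotangent]
    congr 1
    apply Subtype.ext
    exact Θe.apply_symm_apply b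

/-- The chart isomorphism `Θ : T ⊗_R Γ(𝒜, W) ≅ Γ(𝒜_T, W_T)` as a `T`-ALGEBRA map (`Θ(a ⊗ 1) = t^♯ a` is the structure map of the
chart ring of `𝒜_T`). [cite: GortzWedhorn2020, Prop. 4.20] -/
def fibreChartAlgHom {W : 𝒜.X.left.Opens} (hW : IsAffineOpen W) :
    T ⊗[R] ChartRing 𝒜.X.hom W →ₐ[T] ChartRing (𝒜.baseChange (algebraMap R T)).X.hom (𝒜.bcChart T W) where
  toRingHom := (ChartRing.mk (𝒜.baseChange (algebraMap R T)).X.hom (𝒜.bcChart T W)).comp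
    (fibreChartIso 𝒜.X.hom (𝒜.bcFst T) (𝒜.baseChange (algebraMap R T)).X.hom (𝒜.isPullback_bcFst T) hW).toRingHom
  commutes' a := by
    change ChartRing.mk _ _ (fibreChartIso 𝒜.X.hom (𝒜.bcFst T) (𝒜.baseChange (algebraMap R T)).X.hom
      (𝒜.isPullback_bcFst T) hW (algebraMap T (T ⊗[R] ChartRing 𝒜.X.hom W) a)) = _
    rw [Algebra.TensorProduct.algebraMap_apply, Algebra.algebraMap_self, RingHom.id_apply, fibreChartIso_tmul_one]
    rfl

/-- `fibreChartAlgHom` is the chart isomorphism (as a function). [cite: GortzWedhorn2020, Prop. 4.20] -/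
theorem fibreChartAlgHom_apply {W : 𝒜.X.left.Opens} (hW : IsAffineOpen W) (x : T ⊗[R] ChartRing 𝒜.X.hom W) :
    𝒜.fibreChartAlgHom T hW x = ChartRing.mk _ _ (fibreChartIso 𝒜.X.hom (𝒜.bcFst T)
      (𝒜.baseChange (algebraMap R T)).X.hom (𝒜.isPullback_bcFst T) hW x) := rfl

/-- `fibreChartAlgHom` is bijective. [cite: GortzWedhorn2020, Prop. 4.20] -/
theorem fibreChartAlgHom_bijective {W : 𝒜.X.left.Opens} (hW : IsAffineOpen W) :
    Function.Bijective (𝒜.fibreChartAlgHom T hW) :=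
  (fibreChartIso 𝒜.X.hom (𝒜.bcFst T) (𝒜.baseChange (algebraMap R T)).X.hom (𝒜.isPullback_bcFst T) hW).bijective

/-- `ker ε_T ≤ Θ⁻¹ (ker ε_{W_T})`. [cite: GortzWedhorn2023, Remark 17.15 (1)] -/
theorem augIdeal_baseChangeAugmentation_le_comap {W : 𝒜.X.left.Opens} (hW : IsAffineOpen W)
    (heW : η[𝒜.X].left ⁻¹ᵁ W = ⊤) :
    augIdeal (baseChangeAugmentation (sectionAug 𝒜.X.hom η[𝒜.X].left 𝒜.unit_left_comp_hom heW) T) ≤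
      (augIdeal (sectionAug (𝒜.baseChange (algebraMap R T)).X.hom η[(𝒜.baseChange (algebraMap R T)).X].left
        ((𝒜.baseChange (algebraMap R T)).unit_left_comp_hom) (𝒜.unit_preimage_bcChart_eq_top T heW))).comap
        (𝒜.fibreChartAlgHom T hW) := by
  intro x hx
  rw [Ideal.mem_comap, mem_augIdeal_iff, fibreChartAlgHom_apply, 𝒜.sectionAug_baseChange_fibreChartIso T hW heW x]
  exact (mem_augIdeal_iff _ x).1 hx

/-- **`(ker ε_T)/(ker ε_T)² ≃ₗ[T] (ker ε_{W_T})/(ker ε_{W_T})²`**: the conormal module of the base-changed augmentation is the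
conormal module of the unit section of `𝒜_T` read in the base-changed chart `W_T`. [cite: GortzWedhorn2023, Remark 17.15 (1)]
[cite: EGAIV4, (16.2.3) and (16.4.9)] -/
def cotangentChartBaseChangeEquiv {W : 𝒜.X.left.Opens} (hW : IsAffineOpen W) (heW : η[𝒜.X].left ⁻¹ᵁ W = ⊤) :
    (augIdeal (baseChangeAugmentation (sectionAug 𝒜.X.hom η[𝒜.X].left 𝒜.unit_left_comp_hom heW) T)).Cotangent ≃ₗ[T]
      (augIdeal (sectionAug (𝒜.baseChange (algebraMap R T)).X.hom η[(𝒜.baseChange (algebraMap R T)).X].left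
        ((𝒜.baseChange (algebraMap R T)).unit_left_comp_hom) (𝒜.unit_preimage_bcChart_eq_top T heW))).Cotangent :=
  LinearEquiv.ofBijective
    (Ideal.mapCotangent _ _ (𝒜.fibreChartAlgHom T hW) (𝒜.augIdeal_baseChangeAugmentation_le_comap T hW heW))
    (mapCotangent_bijective_of_map_eq T (𝒜.fibreChartAlgHom T hW) (𝒜.fibreChartAlgHom_bijective T hW) _ _
      (𝒜.map_fibreChartIso_augIdeal_baseChangeAugmentation T hW heW)
      (𝒜.augIdeal_baseChangeAugmentation_le_comap T hW heW))

/-- **`T ⊗_R I/I² ≃ₗ[T] (ker ε_{W_T})/(ker ε_{W_T})²**`: the conormal module of the unit section of `𝒜_T` in the chart `W_T` is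
the base change of the conormal module of the unit section of `𝒜` in the chart `W` (composite with A-p11's
`tensorCotangentEquivAugIdealBaseChangeAugmentation`). [cite: EGAIV4, (16.2.3) and (16.4.9)]
[cite: GortzWedhorn2020, Remark 6.12 (2)–(3)] -/
def tensorCotangentChartEquiv {W : 𝒜.X.left.Opens} (hW : IsAffineOpen W) (heW : η[𝒜.X].left ⁻¹ᵁ W = ⊤) :
    T ⊗[R] (augIdeal (sectionAug 𝒜.X.hom η[𝒜.X].left 𝒜.unit_left_comp_hom heW)).Cotangent ≃ₗ[T]
      (augIdeal (sectionAug (𝒜.baseChange (algebraMap R T)).X.hom η[(𝒜.baseChange (algebraMap R T)).X].left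
        ((𝒜.baseChange (algebraMap R T)).unit_left_comp_hom) (𝒜.unit_preimage_bcChart_eq_top T heW))).Cotangent :=
  tensorCotangentEquivAugIdealBaseChangeAugmentation _ T ≪≫ₗ 𝒜.cotangentChartBaseChangeEquiv T hW heW

/-- **`Γ(𝒜, W)` is noetherian when `R` is** (an affine open of a scheme of finite type over a noetherian ring), so the conormal
module `I/I²` of the unit section is a finite `Γ(𝒜, W)`-module. [cite: GortzWedhorn2020, Remark 6.12 (2)–(3)] -/
theorem finite_cotangent_sectionAug [IsNoetherianRing R] {W : 𝒜.X.left.Opens} (hW : IsAffineOpen W)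
    (heW : η[𝒜.X].left ⁻¹ᵁ W = ⊤) :
    Module.Finite (ChartRing 𝒜.X.hom W) (augIdeal (sectionAug 𝒜.X.hom η[𝒜.X].left 𝒜.unit_left_comp_hom heW)).Cotangent := by
  haveI := 𝒜.isProper
  haveI : IsLocallyNoetherian (Spec (CommRingCat.of R)) := isLocallyNoetherian_Spec.2 ‹_›
  haveI : IsLocallyNoetherian 𝒜.X.left := LocallyOfFiniteType.isLocallyNoetherian 𝒜.X.hom
  haveI : IsNoetherianRing Γ(𝒜.X.left, W) := IsLocallyNoetherian.component_noetherian ⟨W, hW⟩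
  haveI : IsNoetherianRing (ChartRing 𝒜.X.hom W) := ‹IsNoetherianRing Γ(𝒜.X.left, W)›
  exact Module.Finite.of_surjective _ (Ideal.toCotangent_surjective _)

/-! ## §4 Generic freeness of the conormal module at the unit section -/

/-- **Generic freeness at the unit section.**  Let `R` be a noetherian domain, `𝒜/R` an abelian scheme and `W ⊆ 𝒜` an affine
open containing the unit section.  Then there is `r ≠ 0` in `R` such that, over `R₁ = R[1/r]`, the conormal module of the unit
section of `𝒜_{R₁}` read in the chart `W_{R₁} = p⁻¹ W` is FREE of finite rank (generic freeness of `I/I²`, A-p11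
`exists_ne_zero_free_cotangent_augIdeal_baseChangeAugmentation`, transported along `cotangentChartBaseChangeEquiv`).
[cite: EGAIV3, (8.9.4)] [cite: GortzWedhorn2023, Remark 17.15 (1)] -/
theorem exists_ne_zero_free_cotangent_bcChart [IsDomain R] [IsNoetherianRing R] {W : 𝒜.X.left.Opens}
    (hW : IsAffineOpen W) (heW : η[𝒜.X].left ⁻¹ᵁ W = ⊤) :
    ∃ r : R, r ≠ 0 ∧
      Module.Free (Localization.Away r) (augIdeal (sectionAug (𝒜.baseChange (algebraMap R (Localization.Away r))).X.hom
        η[(𝒜.baseChange (algebraMap R (Localization.Away r))).X].left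
        ((𝒜.baseChange (algebraMap R (Localization.Away r))).unit_left_comp_hom)
        (𝒜.unit_preimage_bcChart_eq_top (Localization.Away r) heW))).Cotangent ∧
      Module.Finite (Localization.Away r) (augIdeal (sectionAug (𝒜.baseChange (algebraMap R (Localization.Away r))).X.hom
        η[(𝒜.baseChange (algebraMap R (Localization.Away r))).X].left
        ((𝒜.baseChange (algebraMap R (Localization.Away r))).unit_left_comp_hom)
        (𝒜.unit_preimage_bcChart_eq_top (Localization.Away r) heW))).Cotangent := by
  haveI := 𝒜.finite_cotangent_sectionAug hW heW
  obtain ⟨r, hr, hfree, hfin⟩ := exists_ne_zero_free_cotangent_augIdeal_baseChangeAugmentation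
    (sectionAug 𝒜.X.hom η[𝒜.X].left 𝒜.unit_left_comp_hom heW)
  haveI := hfree
  haveI := hfin
  exact ⟨r, hr, Module.Free.of_equiv (𝒜.cotangentChartBaseChangeEquiv (Localization.Away r) hW heW),
    Module.Finite.equiv (𝒜.cotangentChartBaseChangeEquiv (Localization.Away r) hW heW)⟩

end Literature.AlgebraicGeometry.AbelianSchemes.AbelianScheme

end
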